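import Summits.QuantumFields.BalabanUV.T4Continuum.Support.NE9DilatedTables
import Summits.QuantumFields.BalabanUV.T4Continuum.Support.NE9TiltedShell

/-!
# NE9FormGaussian — the last-coupling two-point bound of (2.14)-FORM activities IN GAUSSIAN LETTERS: under the
(2.15)–(2.22)-type DOMINATION of the integrand by a tilted Gaussian density, the weighted cut-off majorant (A″₁) and the
cut-off SHELL majorant (SHELL) are DISCHARGED with explicit constants, so the activity-level bound holds from three
printed-TYPE inputs only — small-field analyticity of the tables, their box bounds, the domination (cell `pub-balaban`,
T4-DAG §2 node U3 / §6 NE9; lineage t4-ne9-p1 = prover P1 «analytic-dependence route», generation 20; census §27 of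
`t4/T4-EST-NE9-P1.md`)

HONEST FRAMING (T4-DAG PAGE 1).  The cell's T⁴ target is rung (B)+1: existence AND uniqueness of the ε → 0 limit of
gauge-invariant observables of pure YM₄ on a FIXED finite torus, with `FlowStep.BetaPertH` and Bałaban's UV stability (B)
as EXPLICIT hypotheses — NOT infinite volume, NOT a mass gap, NOT the Clay problem.  NE9 (`T4OutputRate.NE9` ∧
`FadingMemory`) is a cell NEW ESTIMATE, NOT PRINTED, and is NOT discharged here.  This module is elementary Gaussian measure
theory on a finite-dimensional real inner product space `E` (standard Gaussian `𝒩`, a symmetric `T` with `C = T²` playing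
the fluctuation covariance, scalar bond functionals `z ↦ ⟨u_b, Tz⟩`); it asserts NOTHING about Bałaban's functionals.  [II] =
[Balaban1988RG2Cluster] is quoted for the TYPE of displayed hypotheses only (ABSOLUTE RULE).  BetaPertH, (B), (B^μ) do not
occur.

WHAT THIS CLOSES.  After generation 20's `NE9LocalTwoPoint` (two-point bound localised to the cut-off sets, cut-off with
large-field factors) and `NE9DilatedTables` ([S1-c] as a kernel composition), the activity-level bound displayed, besides
analyticity and box bounds, two INTEGRAL majorants: (A″₁) `∫ 1_{S(s)∩S(s′)}‖pre‖ê₁e^{ê} d𝒩 ≤ T₁` and (SHELL)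
`∫ 1_{S(s)ΔS(s′)}‖pre‖e^{ê} d𝒩 ≤ Sh`.  Print reaches its majorants through the DOMINATION (2.15)→(2.22) p. 15–16: absolute
values inside the integral, the quadratic forms bounded by `½α₅‖B‖²`-type tilts ((2.20)–(2.21)), the characteristic functions
by `exp(−½γ₂ε₁²g_k^{−2}|P| + ½γ₂‖PB‖²)` ((2.22)), leaving the tilted Gaussian integral (2.23) p. 17 with a linear term
`−⟨B, Γ_kX⟩`.  TYPED: `‖pre(z)‖·e^{ê(z)} ≤ M₀·exp(½α‖Tz‖² + ⟨h, Tz⟩)` and `‖pre(z)‖·ê₁(z)·e^{ê(z)} ≤ M₁·exp(½α‖Tz‖² + ⟨h, Tz⟩)`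
(`0 ≤ α`, `αt_i² < 1` — print's «α₅‖C^{(k)}(Z₀,0)‖ sufficiently small»).  KERNEL (§1–§2): under such a domination every
`∫ 1_A f d𝒩 ≤ M·Π_i(1 − αt_i²)^{−1/2}e^{(t_i⟨h,b_i⟩)²/(2(1−αt_i²))}` ((2.24)'s determinant × the completed square; eigenbasis
rotation + `NE9TiltedProduct.lintegral_mul_tiltFun`), the dominated functions are INTEGRABLE, and the shell majorant over the
symmetric difference of the FULL cut-offs (small-field bonds `sb`, large-field bonds `lb`) is
`≤ Σ_{b ∈ sb ∪ lb} M₀·Π_i(…)·2ε₁|s⁻¹ − s′⁻¹|/√(2π‖Tu_b‖²)` (`NE9LocalTwoPoint.cutoffLF_symmDiff_subset` +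
`NE9TiltedShell.lintegral_shell_quadLinTilt_le`).  END (§3, `norm_formAct_sub_formAct_le_gaussian`): for (2.14)-form
activities over `(E, 𝒩)` whose exponent has the (2.12) dilation structure,
`‖H_s − H_{s′}‖ ≤ (4|s − s′|/(c·min(s,s′)))·M₁·Π + Σ_{b ∈ sb ∪ lb} M₀·Π·2ε₁|s⁻¹ − s′⁻¹|/√(2π‖Tu_b‖²)`, `Π = Π_i tiltConst`, from:
(i) `F_m` holomorphic on the `(1+c)ε₁` polydisc [[II] Lemma 1–2 TYPE at `ε₁ ↦ (1+c)ε₁`]; (ii) coupling factors holomorphic on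
the dilation domain [powers]; (iii) box bounds `ê` on the cut-off sets, `ê₁` (dilated) on the common region [(1.36)/(1.43)/
(2.20) TYPE]; (iv) the two dominations [(2.15)–(2.22) TYPE]; measurability.  All three channels (tables, exponential, cut-off
shell) are kernel; both moduli are bounded in `t = g⁻²` on `]0, γ]` (`NE9FluctuationStep.inv_min_mul_abs_sub_le`,
`NE9CutoffShell.inv_sub_inv_le`).

NOT PROVED HERE / residual (census §27): the dictionary «Bałaban's integrand after (2.15)–(2.22) IS so dominated, with
`M₀·Π ≤ (2.38)-majorant`» = (2.23)→(2.26)→(2.38) p. 17–20 (random-walk expansions, X-integration (2.25)) — PROOF-INTERIOR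
of (B); bond variables with `dim 𝔤 > 1` (the cut-off «|B(b)| < ε₁g_k^{−1}» is on a `𝔤`-valued variable; here one scalar
functional per bond — radial shells are an elementary extension not done); the contour integrals and the X-Gaussian of
(2.14) (absorbed in `pre`/`M₀`).  NOT summit progress; 0/9 → 0/9.

References (TYPES only): [Balaban1988RG2Cluster] T. Bałaban, CMP 116 (1988) 1–22, (1.34) p. 9, Lemma 2 p. 11, (2.3) p. 12,
(2.14)–(2.15) p. 15, (2.20)–(2.22) p. 16, (2.23)–(2.26) p. 17, Lemma 3 (2.38) p. 20; [Balaban1987RG1] CMP 109 (1987),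
(2.12) p. 268; [Dimock2013] J. Dimock, Rev. Math. Phys. 25 (2013) 1330010, Lemma 22 (template, cut-off coupling fixed).
v1.1 (same seat; APPEND-ONLY over v1 p204271, every v1 declaration byte-identical): §4 `norm_formAct_sub_formAct_le_gaussian_tCurrency`
— the END bound on the window `]0, γ]` in the currency `t = g⁻²`: `≤ ((4M₁Π/c)(γ²/2) + (Σ_b M₀Π·2ε₁/√(2π‖Tu_b‖²))(γ/2))·|s⁻² − s′⁻²|`.
-/

noncomputable section

namespace Summit.QuantumFields.BalabanUV.T4Continuum.NE9FormGaussian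

open MeasureTheory ProbabilityTheory Set Metric NE9TiltedProduct NE9TiltedShell
open scoped NNReal ENNReal BigOperators RealInnerProductSpace symmDiff
open Summit.QuantumFields.BalabanUV.T4Continuum.NE9CouplingTwoPoint
open Summit.QuantumFields.BalabanUV.T4Continuum.NE9LocalTwoPoint
open Summit.QuantumFields.BalabanUV.T4Continuum.NE9DilatedTables

variable {E : Type*} [NormedAddCommGroup E] [InnerProductSpace ℝ E] [FiniteDimensional ℝ E] [MeasurableSpace E]
  [BorelSpace E] {T : E →ₗ[ℝ] E} (hT : T.IsSymmetric) {n : ℕ} (hn : Module.finrank ℝ E = n)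

/-! ## §1 Dominated integrals against the standard Gaussian: the un-pinned tilted mass -/

/-- **THE UN-PINNED TILTED MASS BOUNDS EVERY DOMINATED INTEGRAL** (ℝ≥0∞ form): for `αt_i² < 1` and a measurable `G` with
`0 ≤ G(z) ≤ M·exp(½α‖Tz‖² + ⟨h, Tz⟩)`, `∫⁻ G d𝒩 ≤ M·Π_i(1 − αt_i²)^{−1/2}e^{(t_i⟨h,b_i⟩)²/(2(1−αt_i²))}` — rotate to the
eigenbasis of `T` (`stdGaussian_eq_map_pi_orthonormalBasis`), factorise the exponent (`exp_quadLin_apply_sum_eq_tiltFun`)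
and integrate the product tilt (`lintegral_mul_tiltFun`: (2.24)'s determinant times the completed square).
[cite: Balaban1988RG2Cluster, (2.23)-(2.24) p.17] -/
theorem lintegral_dominated_le {α : ℝ} (hα : ∀ i, α * (hT.eigenvalues hn i) ^ 2 < 1) (h : E) {G : E → ℝ}
    (hGm : Measurable G) {M : ℝ} (hM : 0 ≤ M) (hG : ∀ z, 0 ≤ G z ∧ G z ≤ M * Real.exp (α / 2 * ‖T z‖ ^ 2 + ⟪h, T z⟫)) :
    ∫⁻ z, ENNReal.ofReal (G z) ∂(stdGaussian E) ≤
      ENNReal.ofReal M *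
        (∏ i, (tiltConst (α * (hT.eigenvalues hn i) ^ 2) (hT.eigenvalues hn i * ⟪h, hT.eigenvectorBasis hn i⟫)).toNNReal) := by
  set b := hT.eigenvectorBasis hn with hb
  set β : Fin n → ℝ := fun i => α * (hT.eigenvalues hn i) ^ 2 with hβdef
  set γ : Fin n → ℝ := fun i => hT.eigenvalues hn i * ⟪h, b i⟫ with hγdef
  have hβ : ∀ i, β i < 1 := hα
  have hGSm : Measurable fun z : E => ENNReal.ofReal (G z) := hGm.ennreal_ofReal
  rw [stdGaussian_eq_map_pi_orthonormalBasis b]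
  have hφ : Measurable (fun x : Fin n → ℝ => ∑ i, x i • b i) := by fun_prop
  rw [lintegral_map hGSm hφ]
  have hpt : ∀ w : Fin n → ℝ, ENNReal.ofReal (G (∑ i, w i • b i)) ≤
      (fun _ : Fin n → ℝ => ENNReal.ofReal M) w * ENNReal.ofReal (tiltFun β γ w) := by
    intro w
    rw [← ENNReal.ofReal_mul hM, ← exp_quadLin_apply_sum_eq_tiltFun hT hn α h w]
    exact ENNReal.ofReal_le_ofReal (hG _).2
  calc ∫⁻ w, ENNReal.ofReal (G (∑ i, w i • b i)) ∂(Measure.pi fun _ : Fin n => gaussianReal 0 1)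
      ≤ ∫⁻ w, (fun _ : Fin n → ℝ => ENNReal.ofReal M) w * ENNReal.ofReal (tiltFun β γ w)
          ∂(Measure.pi fun _ : Fin n => gaussianReal 0 1) := lintegral_mono hpt
    _ = (∏ i, (tiltConst (β i) (γ i)).toNNReal) * ∫⁻ _, ENNReal.ofReal M ∂(tiltedPi β γ) :=
        lintegral_mul_tiltFun hβ γ measurable_const
    _ = ENNReal.ofReal M * (∏ i, (tiltConst (β i) (γ i)).toNNReal) := by
        rw [lintegral_const, measure_univ, mul_one, mul_comm]

/-- **DOMINATED ⇒ INTEGRABLE**: a measurable `f` with `0 ≤ f ≤ M·exp(½α‖Tz‖² + ⟨h, Tz⟩)` (`αt_i² < 1`) is integrable against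
the standard Gaussian — the integrability checklist of the form integrals (`NE9LocalTwoPoint.norm_formAct_sub_formAct_le_local`)
discharged from the domination. [folklore] -/
theorem integrable_of_dominated {α : ℝ} (hα : ∀ i, α * (hT.eigenvalues hn i) ^ 2 < 1) (h : E) {f : E → ℝ}
    (hfm : Measurable f) {M : ℝ} (hM : 0 ≤ M) (hf : ∀ z, 0 ≤ f z ∧ f z ≤ M * Real.exp (α / 2 * ‖T z‖ ^ 2 + ⟪h, T z⟫)) :
    Integrable f (stdGaussian E) := by
  refine ⟨hfm.aestronglyMeasurable, ?_⟩
  rw [hasFiniteIntegral_iff_ofReal (ae_of_all _ fun z => (hf z).1)]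
  exact (lintegral_dominated_le hT hn hα h hfm hM hf).trans_lt
    (ENNReal.mul_lt_top ENNReal.ofReal_lt_top ENNReal.coe_lt_top)

/-- **EVERY CUT-OFF INTEGRAL OF A DOMINATED FUNCTION IS AT MOST THE UN-PINNED TILTED MASS** (real form): for a measurable
set `A` (a cut-off set, an intersection of two, …), `∫ 1_A f d𝒩 ≤ M·Π_i tiltConst_i` — the (A″)/(A″₁) majorants of the
lineage in Gaussian letters, the cut-off dropped (`1_A ≤ 1`; the large-field SMALLNESS of (2.22)'s first factor lives in
`M`, not used here). [cite: Balaban1988RG2Cluster, (2.15) p.15 and (2.23)-(2.26) p.17] -/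
theorem integral_indicator_dominated_le {α : ℝ} (hα : ∀ i, α * (hT.eigenvalues hn i) ^ 2 < 1) (h : E) {f : E → ℝ}
    (hfm : Measurable f) {M : ℝ} (hM : 0 ≤ M) (hf : ∀ z, 0 ≤ f z ∧ f z ≤ M * Real.exp (α / 2 * ‖T z‖ ^ 2 + ⟪h, T z⟫))
    {A : Set E} (hA : MeasurableSet A) :
    ∫ z, A.indicator f z ∂(stdGaussian E) ≤
      M * ∏ i, tiltConst (α * (hT.eigenvalues hn i) ^ 2) (hT.eigenvalues hn i * ⟪h, hT.eigenvectorBasis hn i⟫) := by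
  have hnn : ∀ z, 0 ≤ A.indicator f z := fun z => Set.indicator_nonneg (fun z _ => (hf z).1) z
  have hle : ∀ z, A.indicator f z ≤ f z := fun z => Set.indicator_le_self' (fun z _ => (hf z).1) z
  have hind : ∀ z, 0 ≤ A.indicator f z ∧ A.indicator f z ≤ M * Real.exp (α / 2 * ‖T z‖ ^ 2 + ⟪h, T z⟫) :=
    fun z => ⟨hnn z, (hle z).trans (hf z).2⟩
  rw [integral_eq_lintegral_of_nonneg_ae (ae_of_all _ hnn) (hfm.indicator hA).aestronglyMeasurable]
  have hlin := lintegral_dominated_le hT hn hα h (hfm.indicator hA) hM hind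
  have hK : ∀ i, 0 ≤ tiltConst (α * (hT.eigenvalues hn i) ^ 2) (hT.eigenvalues hn i * ⟪h, hT.eigenvectorBasis hn i⟫) :=
    fun i => (tiltConst_pos (hα i) _).le
  have hne : ENNReal.ofReal M *
      (∏ i, (tiltConst (α * (hT.eigenvalues hn i) ^ 2) (hT.eigenvalues hn i * ⟪h, hT.eigenvectorBasis hn i⟫)).toNNReal) ≠ ∞ :=
    ENNReal.mul_ne_top ENNReal.ofReal_ne_top ENNReal.coe_ne_top
  refine (ENNReal.toReal_mono hne hlin).trans (le_of_eq ?_)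
  rw [ENNReal.toReal_mul, ENNReal.toReal_ofReal hM, ENNReal.coe_toReal, NNReal.coe_prod]
  congr 1
  exact Finset.prod_congr rfl fun i _ => Real.coe_toNNReal _ (hK i)

/-! ## §2 The cut-off SHELL of the full cut-off (small-field bonds `sb`, large-field bonds `lb`) under domination -/

/-- **(SHELL) FOR THE FULL CUT-OFF OF A (2.14) TERM, ℝ≥0∞ form**: with bond functionals `u_b` (`Tu_b ≠ 0` on `sb ∪ lb`),
thresholds `ε₁/s`, `ε₁/s′` (`ε₁ ≥ 0`, `s, s′ > 0`), `0 ≤ α`, `αt_i² < 1` and a measurable `G`, `0 ≤ G ≤ M·exp(½α‖Tz‖² + ⟨h,Tz⟩)`: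
`∫⁻ 1_{S(s) Δ S(s′)} G d𝒩 ≤ Σ_{b ∈ sb ∪ lb} M·Π_i(…)·2ε₁|s⁻¹ − s′⁻¹|/√(2π‖Tu_b‖²)`, `S(x)` the cut-off with small-field
factors on `sb` AND large-field factors on `lb` — the symmetric difference lies in the one-bond shells over `sb ∪ lb`
(`NE9LocalTwoPoint.cutoffLF_symmDiff_subset`) and each shell is bounded by `NE9TiltedShell.lintegral_shell_quadLinTilt_le`.
[cite: Balaban1988RG2Cluster, (2.3) p.12, (2.14) p.15 and (2.23) p.17] -/
theorem lintegral_cutoffLFShell_le {Bd : Type*} [DecidableEq Bd] (sb lb : Finset Bd) (ub : Bd → E) {α : ℝ}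
    (hα0 : 0 ≤ α) (hα : ∀ i, α * (hT.eigenvalues hn i) ^ 2 < 1) (h : E) (hub : ∀ b ∈ sb ∪ lb, T (ub b) ≠ 0)
    {ε₁ s s' : ℝ} (hε : 0 ≤ ε₁) (hs : 0 < s) (hs' : 0 < s') {G : E → ℝ} (hGm : Measurable G) {M : ℝ} (hM : 0 ≤ M)
    (hG : ∀ z, 0 ≤ G z ∧ G z ≤ M * Real.exp (α / 2 * ‖T z‖ ^ 2 + ⟪h, T z⟫)) :
    ∫⁻ z, ENNReal.ofReal ((cutoffLF sb lb (fun b (z : E) => ⟪ub b, T z⟫) ε₁ s ∆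
        cutoffLF sb lb (fun b (z : E) => ⟪ub b, T z⟫) ε₁ s').indicator G z) ∂(stdGaussian E) ≤
      ∑ b ∈ sb ∪ lb, ENNReal.ofReal M *
        (∏ i, (tiltConst (α * (hT.eigenvalues hn i) ^ 2) (hT.eigenvalues hn i * ⟪h, hT.eigenvectorBasis hn i⟫)).toNNReal) *
        ENNReal.ofReal (2 * (ε₁ * |s⁻¹ - s'⁻¹|) * (Real.sqrt (2 * Real.pi * ‖T (ub b)‖ ^ 2))⁻¹) := by
  set D : Set E := cutoffLF sb lb (fun b (z : E) => ⟪ub b, T z⟫) ε₁ s ∆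
    cutoffLF sb lb (fun b (z : E) => ⟪ub b, T z⟫) ε₁ s' with hD
  set Sh : Bd → Set E := fun b => {z : E | ε₁ / max s s' ≤ |⟪ub b, T z⟫| ∧ |⟪ub b, T z⟫| < ε₁ / min s s'} with hSh
  have hsub : D ⊆ ⋃ b ∈ sb ∪ lb, Sh b :=
    cutoffLF_symmDiff_subset sb lb (fun b (z : E) => ⟪ub b, T z⟫) hε hs hs'
  have hpt : ∀ z : E, ENNReal.ofReal (D.indicator G z) ≤ ∑ b ∈ sb ∪ lb, ENNReal.ofReal ((Sh b).indicator G z) := by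
    intro z
    by_cases hz : z ∈ D
    · obtain ⟨b₀, hb₀, hzb₀⟩ : ∃ b₀ ∈ sb ∪ lb, z ∈ Sh b₀ := by
        have hz' := hsub hz
        simpa only [Set.mem_iUnion, exists_prop] using hz'
      rw [indicator_of_mem hz]
      calc ENNReal.ofReal (G z) = ENNReal.ofReal ((Sh b₀).indicator G z) := by rw [indicator_of_mem hzb₀]
        _ ≤ ∑ b ∈ sb ∪ lb, ENNReal.ofReal ((Sh b).indicator G z) :=
            Finset.single_le_sum (f := fun b => ENNReal.ofReal ((Sh b).indicator G z)) (fun b _ => zero_le) hb₀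
    · rw [indicator_of_notMem hz, ENNReal.ofReal_zero]
      exact zero_le
  have hmeas : ∀ b ∈ sb ∪ lb, AEMeasurable (fun z : E => ENNReal.ofReal ((Sh b).indicator G z)) (stdGaussian E) :=
    fun b _ => ((hGm.indicator (measurableSet_shell (T := T) (ub b) _ _)).ennreal_ofReal).aemeasurable
  have hle : ε₁ / max s s' ≤ ε₁ / min s s' := div_le_div_of_nonneg_left hε (lt_min hs hs') min_le_max
  calc ∫⁻ z, ENNReal.ofReal (D.indicator G z) ∂(stdGaussian E)
      ≤ ∫⁻ z, ∑ b ∈ sb ∪ lb, ENNReal.ofReal ((Sh b).indicator G z) ∂(stdGaussian E) := lintegral_mono hpt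
    _ = ∑ b ∈ sb ∪ lb, ∫⁻ z, ENNReal.ofReal ((Sh b).indicator G z) ∂(stdGaussian E) := lintegral_finsetSum' _ hmeas
    _ ≤ ∑ b ∈ sb ∪ lb, ENNReal.ofReal M *
          (∏ i, (tiltConst (α * (hT.eigenvalues hn i) ^ 2) (hT.eigenvalues hn i * ⟪h, hT.eigenvectorBasis hn i⟫)).toNNReal) *
          ENNReal.ofReal (2 * (ε₁ * |s⁻¹ - s'⁻¹|) * (Real.sqrt (2 * Real.pi * ‖T (ub b)‖ ^ 2))⁻¹) := by
        refine Finset.sum_le_sum fun b hb => ?_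
        have h1 := lintegral_shell_quadLinTilt_le hT hn hα0 hα h (ub b) (hub b hb) hle hGm hM hG
        rwa [NE9CutoffShell.shellWidth_eq hs hs'] at h1

/-- The cut-off sets of the Gaussian instance are measurable (the bond functionals are continuous). [folklore] -/
theorem measurableSet_cutoffLF_inner {Bd : Type*} (sb lb : Finset Bd) (ub : Bd → E) (ε₁ x : ℝ) :
    MeasurableSet (cutoffLF sb lb (fun b (z : E) => ⟪ub b, T z⟫) ε₁ x) :=
  measurableSet_cutoffLF sb lb (fun _ => (continuous_const.inner T.continuous_of_finiteDimensional).measurable) ε₁ x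

/-- **(SHELL) FOR THE FULL CUT-OFF, real form**: `∫ 1_{S(s) Δ S(s′)} f d𝒩 ≤ Σ_{b ∈ sb ∪ lb} M·Π_i tiltConst_i·2ε₁|s⁻¹ − s′⁻¹|/
√(2π‖Tu_b‖²)` for a measurable `f` with `0 ≤ f ≤ M·exp(½α‖Tz‖² + ⟨h,Tz⟩)` — LINEAR in the threshold displacement, summed over
the small-field AND the large-field bonds. [cite: Balaban1988RG2Cluster, (2.3) p.12 and (2.23)-(2.26) p.17] -/
theorem integral_cutoffLFShell_le {Bd : Type*} [DecidableEq Bd] (sb lb : Finset Bd) (ub : Bd → E) {α : ℝ} (hα0 : 0 ≤ α)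
    (hα : ∀ i, α * (hT.eigenvalues hn i) ^ 2 < 1) (h : E) (hub : ∀ b ∈ sb ∪ lb, T (ub b) ≠ 0) {ε₁ s s' : ℝ}
    (hε : 0 ≤ ε₁) (hs : 0 < s) (hs' : 0 < s') {f : E → ℝ} (hfm : Measurable f) {M : ℝ} (hM : 0 ≤ M)
    (hf : ∀ z, 0 ≤ f z ∧ f z ≤ M * Real.exp (α / 2 * ‖T z‖ ^ 2 + ⟪h, T z⟫)) :
    ∫ z, (cutoffLF sb lb (fun b (z : E) => ⟪ub b, T z⟫) ε₁ s ∆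
        cutoffLF sb lb (fun b (z : E) => ⟪ub b, T z⟫) ε₁ s').indicator f z ∂(stdGaussian E) ≤
      ∑ b ∈ sb ∪ lb, M *
        (∏ i, tiltConst (α * (hT.eigenvalues hn i) ^ 2) (hT.eigenvalues hn i * ⟪h, hT.eigenvectorBasis hn i⟫)) *
        (2 * (ε₁ * |s⁻¹ - s'⁻¹|) * (Real.sqrt (2 * Real.pi * ‖T (ub b)‖ ^ 2))⁻¹) := by
  set D : Set E := cutoffLF sb lb (fun b (z : E) => ⟪ub b, T z⟫) ε₁ s ∆
    cutoffLF sb lb (fun b (z : E) => ⟪ub b, T z⟫) ε₁ s' with hD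
  have hDm : MeasurableSet D :=
    (measurableSet_cutoffLF_inner (T := T) sb lb ub ε₁ s).symmDiff (measurableSet_cutoffLF_inner (T := T) sb lb ub ε₁ s')
  have hnn : 0 ≤ᵐ[stdGaussian E] fun z => D.indicator f z :=
    ae_of_all _ fun z => Set.indicator_nonneg (fun z _ => (hf z).1) z
  rw [integral_eq_lintegral_of_nonneg_ae hnn (hfm.indicator hDm).aestronglyMeasurable]
  have hlin := lintegral_cutoffLFShell_le hT hn sb lb ub hα0 hα h hub hε hs hs' hfm hM hf
  have hK : ∀ i, 0 ≤ tiltConst (α * (hT.eigenvalues hn i) ^ 2) (hT.eigenvalues hn i * ⟪h, hT.eigenvectorBasis hn i⟫) :=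
    fun i => (tiltConst_pos (hα i) _).le
  have hBb : ∀ b, 0 ≤ 2 * (ε₁ * |s⁻¹ - s'⁻¹|) * (Real.sqrt (2 * Real.pi * ‖T (ub b)‖ ^ 2))⁻¹ := fun b => by positivity
  have hne : ∑ b ∈ sb ∪ lb, ENNReal.ofReal M *
      (∏ i, (tiltConst (α * (hT.eigenvalues hn i) ^ 2) (hT.eigenvalues hn i * ⟪h, hT.eigenvectorBasis hn i⟫)).toNNReal) *
      ENNReal.ofReal (2 * (ε₁ * |s⁻¹ - s'⁻¹|) * (Real.sqrt (2 * Real.pi * ‖T (ub b)‖ ^ 2))⁻¹) ≠ ∞ :=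
    ENNReal.sum_ne_top.2 fun b _ =>
      ENNReal.mul_ne_top (ENNReal.mul_ne_top ENNReal.ofReal_ne_top ENNReal.coe_ne_top) ENNReal.ofReal_ne_top
  refine (ENNReal.toReal_mono hne hlin).trans (le_of_eq ?_)
  rw [ENNReal.toReal_sum fun b _ =>
    ENNReal.mul_ne_top (ENNReal.mul_ne_top ENNReal.ofReal_ne_top ENNReal.coe_ne_top) ENNReal.ofReal_ne_top]
  refine Finset.sum_congr rfl fun b _ => ?_
  rw [ENNReal.toReal_mul, ENNReal.toReal_mul, ENNReal.toReal_ofReal hM, ENNReal.toReal_ofReal (hBb b),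
    ENNReal.coe_toReal, NNReal.coe_prod]
  congr 2
  exact Finset.prod_congr rfl fun i _ => Real.coe_toNNReal _ (hK i)

/-! ## §3 END: the activity-level two-point bound in Gaussian letters -/

/-- **THE LAST-COUPLING TWO-POINT BOUND OF (2.14)-FORM ACTIVITIES IN GAUSSIAN LETTERS — every channel kernel, only
printed-TYPE inputs displayed.**  Setting: fluctuation field `B = Tz`, `z` standard Gaussian on `E` (`C = T²`), cut-off
`S(x)` = small-field factors `|⟨u_b,Tz⟩| < ε₁/x` on `sb` AND large-field factors `ε₁/x ≤ |⟨u_b,Tz⟩|` on `lb` ([II] (2.3),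
(2.14)), activity `H_x = ∫ 1_{S(x)}·pre·exp(Σ_m a_m(x)F_m(x • φ)) d𝒩` with the (2.12) dilation structure of the exponent and
the bond coordinates of the complexified field dominated by the cut-off's bond variables on `ab ⊆ sb`.  DISPLAYED (each a
printed TYPE, none a printed statement): (i) `F_m` holomorphic on the `(1+c)ε₁` polydisc [Lemma 1–2 p. 9/11 at
`ε₁ ↦ (1+c)ε₁`]; (ii) coupling factors holomorphic on the dilation domain [powers of `g_k`;
`NE9DilatedTables.differentiableOn_zpow_dilationDomain`]; (iii) box bounds: `ê` on the cut-off sets, `ê₁ ≥ 0` for the dilated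
tables on the common region [(1.36)/(1.43)/(2.20)]; (iv) DOMINATION of `‖pre‖e^{ê}` by `M₀·exp(½α‖Tz‖² + ⟨h,Tz⟩)` and of
`‖pre‖ê₁e^{ê}` by `M₁·exp(…)` [(2.15)–(2.22) p. 15–16; `0 ≤ α`, `αt_i² < 1` = «α₅‖C‖ small» p. 17]; measurability.
CONCLUSION: `‖H_s − H_{s′}‖ ≤ (4|s − s′|/(c·min(s,s′)))·M₁·Π + Σ_{b ∈ sb ∪ lb} M₀·Π·2ε₁|s⁻¹ − s′⁻¹|/√(2π‖Tu_b‖²)` with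
`Π = Π_i (1 − αt_i²)^{−1/2}e^{(t_i⟨h,b_i⟩)²/(2(1−αt_i²))}` ((2.24)).  Kernel route: [S1-c] composition
(`NE9DilatedTables.norm_dilTables_sub_le`) + localised three-channel bound (`NE9LocalTwoPoint`) + §1 (integrability and
(A″₁) from domination) + §2 ((SHELL) from domination).  Residual for Bałaban's terms: the dictionary to (2.23) and
`M₀·Π ≤` the (2.38)-majorant ((2.25)–(2.26), PROOF-INTERIOR of (B)); `dim 𝔤 > 1` radial shells.
[cite: Balaban1988RG2Cluster, (1.34) p.9, Lemma 2 p.11, (2.3) p.12, (2.14)-(2.15) p.15, (2.20)-(2.22) p.16, (2.23)-(2.24) p.17; Balaban1987RG1, (2.12) p.268] -/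
theorem norm_formAct_sub_formAct_le_gaussian {Bd : Type*} [DecidableEq Bd] {sb lb ab : Finset Bd} (ub : Bd → E)
    {W : Type*} [NormedAddCommGroup W] [NormedSpace ℂ W] {Vc : Type*} [NormedAddCommGroup Vc] [NormedSpace ℂ Vc]
    {φ : E → W} {ℓ : Bd → W →L[ℂ] Vc} {TM : Type*} {terms : Finset TM} {a : TM → ℂ → ℂ} {F : TM → W → ℂ}
    {pre : E → ℂ} {e e₁ : E → ℝ} {α ε₁ c s s' M₀ M₁ : ℝ} (h : E)
    (hα0 : 0 ≤ α) (hα : ∀ i, α * (hT.eigenvalues hn i) ^ 2 < 1) (hub : ∀ b ∈ sb ∪ lb, T (ub b) ≠ 0)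
    -- measurability checklist
    (hprem : Measurable pre) (hem : Measurable e) (he₁m : Measurable e₁)
    (hVs : AEStronglyMeasurable (fun z => dilTables terms a F φ s z) (stdGaussian E))
    (hVs' : AEStronglyMeasurable (fun z => dilTables terms a F φ s' z) (stdGaussian E))
    (he₁ : ∀ z, 0 ≤ e₁ z) (hε : 0 ≤ ε₁) (hc : 0 < c) (hs : 0 < s) (hs' : 0 < s') (hM₀ : 0 ≤ M₀) (hM₁ : 0 ≤ M₁)
    -- the link between the cut-off's bond variables and the polydisc's bond coordinates
    (hab : ab ⊆ sb) (hlink : ∀ z, ∀ b ∈ ab, ‖ℓ b (φ z)‖ ≤ |⟪ub b, T z⟫|)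
    -- (i)/(ii) analyticity [Lemma 1–2 TYPE at (1+c)ε₁]; coupling factors
    (hF : ∀ m ∈ terms, DifferentiableOn ℂ (F m) (smallFieldPolydisc ab ℓ ((1 + c) * ε₁)))
    (ha : ∀ m ∈ terms, DifferentiableOn ℂ (a m) (dilationDomain (min s s') (max s s') (c * min s s')))
    -- (iii) box bounds [(1.36)/(1.43)/(2.20) TYPE]
    (hbd : ∀ z ∈ cutoffLF sb lb (fun b (z : E) => ⟪ub b, T z⟫) ε₁ s, ‖dilTables terms a F φ s z‖ ≤ e z)
    (hbd' : ∀ z ∈ cutoffLF sb lb (fun b (z : E) => ⟪ub b, T z⟫) ε₁ s', ‖dilTables terms a F φ s' z‖ ≤ e z)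
    (hdil : ∀ z ∈ cutoffLF sb lb (fun b (z : E) => ⟪ub b, T z⟫) ε₁ s ∩ cutoffLF sb lb (fun b (z : E) => ⟪ub b, T z⟫) ε₁ s',
      ∀ ζ ∈ dilationDomain (min s s') (max s s') (c * min s s'), ‖dilTables terms a F φ ζ z‖ ≤ e₁ z)
    -- (iv) DOMINATION [(2.15)–(2.22) TYPE]
    (hdom₀ : ∀ z, ‖pre z‖ * Real.exp (e z) ≤ M₀ * Real.exp (α / 2 * ‖T z‖ ^ 2 + ⟪h, T z⟫))
    (hdom₁ : ∀ z, ‖pre z‖ * e₁ z * Real.exp (e z) ≤ M₁ * Real.exp (α / 2 * ‖T z‖ ^ 2 + ⟪h, T z⟫)) :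
    ‖formAct (stdGaussian E) (cutoffLF sb lb (fun b (z : E) => ⟪ub b, T z⟫) ε₁) pre
          (fun x z => dilTables terms a F φ x z) s -
        formAct (stdGaussian E) (cutoffLF sb lb (fun b (z : E) => ⟪ub b, T z⟫) ε₁) pre
          (fun x z => dilTables terms a F φ x z) s'‖ ≤
      4 * |s - s'| / (c * min s s') *
          (M₁ * ∏ i, tiltConst (α * (hT.eigenvalues hn i) ^ 2) (hT.eigenvalues hn i * ⟪h, hT.eigenvectorBasis hn i⟫)) +
        ∑ b ∈ sb ∪ lb, M₀ *
          (∏ i, tiltConst (α * (hT.eigenvalues hn i) ^ 2) (hT.eigenvalues hn i * ⟪h, hT.eigenvectorBasis hn i⟫)) *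
          (2 * (ε₁ * |s⁻¹ - s'⁻¹|) * (Real.sqrt (2 * Real.pi * ‖T (ub b)‖ ^ 2))⁻¹) := by
  have hBm : ∀ b, Measurable (fun z : E => ⟪ub b, T z⟫) :=
    fun _ => (continuous_const.inner T.continuous_of_finiteDimensional).measurable
  -- the two dominated functions
  have hf₀m : Measurable fun z => ‖pre z‖ * Real.exp (e z) := hprem.norm.mul (Real.measurable_exp.comp hem)
  have hf₁m : Measurable fun z => ‖pre z‖ * e₁ z * Real.exp (e z) :=
    (hprem.norm.mul he₁m).mul (Real.measurable_exp.comp hem)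
  have hf₀ : ∀ z, 0 ≤ ‖pre z‖ * Real.exp (e z) ∧ ‖pre z‖ * Real.exp (e z) ≤ M₀ * Real.exp (α / 2 * ‖T z‖ ^ 2 + ⟪h, T z⟫) :=
    fun z => ⟨by positivity, hdom₀ z⟩
  have hf₁ : ∀ z, 0 ≤ ‖pre z‖ * e₁ z * Real.exp (e z) ∧
      ‖pre z‖ * e₁ z * Real.exp (e z) ≤ M₁ * Real.exp (α / 2 * ‖T z‖ ^ 2 + ⟪h, T z⟫) :=
    fun z => ⟨mul_nonneg (mul_nonneg (norm_nonneg _) (he₁ z)) (Real.exp_pos _).le, hdom₁ z⟩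
  have hint₀ : Integrable (fun z => ‖pre z‖ * Real.exp (e z)) (stdGaussian E) :=
    integrable_of_dominated hT hn hα h hf₀m hM₀ hf₀
  have hint₁ : Integrable (fun z => ‖pre z‖ * e₁ z * Real.exp (e z)) (stdGaussian E) :=
    integrable_of_dominated hT hn hα h hf₁m hM₁ hf₁
  have hT₁ := integral_indicator_dominated_le hT hn hα h hf₁m hM₁ hf₁
    ((measurableSet_cutoffLF_inner (T := T) sb lb ub ε₁ s).inter (measurableSet_cutoffLF_inner (T := T) sb lb ub ε₁ s'))
  have hSh := integral_cutoffLFShell_le hT hn sb lb ub hα0 hα h hub hε hs hs' hf₀m hM₀ hf₀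
  exact norm_formAct_sub_formAct_le_dilTables hBm hprem.aestronglyMeasurable hVs hVs' hint₀ hint₁ hc hs hs' hab hlink hF
    ha hbd hbd' hdil hT₁ hSh

/-! ## §4 (v1.1) The Gaussian-letters bound in the currency `t = g⁻²` -/

/-- **THE GAUSSIAN-LETTERS TWO-POINT BOUND IN THE CURRENCY `t = g⁻²`** (the shape node U3/U2 consume, cf.
`NE9LastCouplingBridge.norm_formAct_sub_formAct_le_tCurrency` for g18's abstract bound): on the window `]0, γ]`, with the
dilation aperture `c` fixed, the conclusion of `norm_formAct_sub_formAct_le_gaussian` reads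
`‖H_s − H_{s′}‖ ≤ ((4M₁Π/c)·(γ²/2) + (Σ_{b ∈ sb ∪ lb} M₀Π·2ε₁/√(2π‖Tu_b‖²))·(γ/2))·|s⁻² − s′⁻²|` — a modulus LINEAR in
`t = g⁻²` with a coupling-FREE constant (conversions `NE9FluctuationStep.inv_min_mul_abs_sub_le`, `NE9CutoffShell.inv_sub_inv_le`).
[cite: Balaban1987RG1, (2.15) p.268 and Thm 1 p.259; Balaban1988RG2Cluster, (2.14)-(2.15) p.15] -/
theorem norm_formAct_sub_formAct_le_gaussian_tCurrency {Bd : Type*} [DecidableEq Bd] {sb lb ab : Finset Bd} (ub : Bd → E)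
    {W : Type*} [NormedAddCommGroup W] [NormedSpace ℂ W] {Vc : Type*} [NormedAddCommGroup Vc] [NormedSpace ℂ Vc]
    {φ : E → W} {ℓ : Bd → W →L[ℂ] Vc} {TM : Type*} {terms : Finset TM} {a : TM → ℂ → ℂ} {F : TM → W → ℂ}
    {pre : E → ℂ} {e e₁ : E → ℝ} {α ε₁ c s s' γ M₀ M₁ : ℝ} (h : E)
    (hα0 : 0 ≤ α) (hα : ∀ i, α * (hT.eigenvalues hn i) ^ 2 < 1) (hub : ∀ b ∈ sb ∪ lb, T (ub b) ≠ 0)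
    (hprem : Measurable pre) (hem : Measurable e) (he₁m : Measurable e₁)
    (hVs : AEStronglyMeasurable (fun z => dilTables terms a F φ s z) (stdGaussian E))
    (hVs' : AEStronglyMeasurable (fun z => dilTables terms a F φ s' z) (stdGaussian E))
    (he₁ : ∀ z, 0 ≤ e₁ z) (hε : 0 ≤ ε₁) (hc : 0 < c) (hs : 0 < s) (hsγ : s ≤ γ) (hs' : 0 < s') (hs'γ : s' ≤ γ)
    (hM₀ : 0 ≤ M₀) (hM₁ : 0 ≤ M₁)
    (hab : ab ⊆ sb) (hlink : ∀ z, ∀ b ∈ ab, ‖ℓ b (φ z)‖ ≤ |⟪ub b, T z⟫|)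
    (hF : ∀ m ∈ terms, DifferentiableOn ℂ (F m) (smallFieldPolydisc ab ℓ ((1 + c) * ε₁)))
    (ha : ∀ m ∈ terms, DifferentiableOn ℂ (a m) (dilationDomain (min s s') (max s s') (c * min s s')))
    (hbd : ∀ z ∈ cutoffLF sb lb (fun b (z : E) => ⟪ub b, T z⟫) ε₁ s, ‖dilTables terms a F φ s z‖ ≤ e z)
    (hbd' : ∀ z ∈ cutoffLF sb lb (fun b (z : E) => ⟪ub b, T z⟫) ε₁ s', ‖dilTables terms a F φ s' z‖ ≤ e z)
    (hdil : ∀ z ∈ cutoffLF sb lb (fun b (z : E) => ⟪ub b, T z⟫) ε₁ s ∩ cutoffLF sb lb (fun b (z : E) => ⟪ub b, T z⟫) ε₁ s',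
      ∀ ζ ∈ dilationDomain (min s s') (max s s') (c * min s s'), ‖dilTables terms a F φ ζ z‖ ≤ e₁ z)
    (hdom₀ : ∀ z, ‖pre z‖ * Real.exp (e z) ≤ M₀ * Real.exp (α / 2 * ‖T z‖ ^ 2 + ⟪h, T z⟫))
    (hdom₁ : ∀ z, ‖pre z‖ * e₁ z * Real.exp (e z) ≤ M₁ * Real.exp (α / 2 * ‖T z‖ ^ 2 + ⟪h, T z⟫)) :
    ‖formAct (stdGaussian E) (cutoffLF sb lb (fun b (z : E) => ⟪ub b, T z⟫) ε₁) pre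
          (fun x z => dilTables terms a F φ x z) s -
        formAct (stdGaussian E) (cutoffLF sb lb (fun b (z : E) => ⟪ub b, T z⟫) ε₁) pre
          (fun x z => dilTables terms a F φ x z) s'‖ ≤
      ((4 * (M₁ * ∏ i, tiltConst (α * (hT.eigenvalues hn i) ^ 2)
            (hT.eigenvalues hn i * ⟪h, hT.eigenvectorBasis hn i⟫)) / c) * (γ ^ 2 / 2) +
        (∑ b ∈ sb ∪ lb, M₀ *
          (∏ i, tiltConst (α * (hT.eigenvalues hn i) ^ 2) (hT.eigenvalues hn i * ⟪h, hT.eigenvectorBasis hn i⟫)) *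
          (2 * ε₁ * (Real.sqrt (2 * Real.pi * ‖T (ub b)‖ ^ 2))⁻¹)) * (γ / 2)) * |(s ^ 2)⁻¹ - (s' ^ 2)⁻¹| := by
  set Pt : ℝ := ∏ i, tiltConst (α * (hT.eigenvalues hn i) ^ 2) (hT.eigenvalues hn i * ⟪h, hT.eigenvectorBasis hn i⟫)
    with hPt
  have hK : ∀ i, 0 ≤ tiltConst (α * (hT.eigenvalues hn i) ^ 2) (hT.eigenvalues hn i * ⟪h, hT.eigenvectorBasis hn i⟫) :=
    fun i => (tiltConst_pos (hα i) _).le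
  have hPt0 : 0 ≤ Pt := Finset.prod_nonneg fun i _ => hK i
  have hmin : 0 < min s s' := lt_min hs hs'
  have hg := norm_formAct_sub_formAct_le_gaussian hT hn ub h hα0 hα hub hprem hem he₁m hVs hVs' he₁ hε hc hs hs' hM₀ hM₁
    hab hlink hF ha hbd hbd' hdil hdom₀ hdom₁
  have h1 : 4 * |s - s'| / (c * min s s') * (M₁ * Pt) ≤ 4 * (M₁ * Pt) / c * (γ ^ 2 / 2) * |(s ^ 2)⁻¹ - (s' ^ 2)⁻¹| := by
    have hconv := NE9FluctuationStep.inv_min_mul_abs_sub_le hs hsγ hs' hs'γ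
    have heq : 4 * |s - s'| / (c * min s s') * (M₁ * Pt) = 4 * (M₁ * Pt) / c * ((min s s')⁻¹ * |s - s'|) := by
      field_simp
    rw [heq, mul_assoc (4 * (M₁ * Pt) / c)]
    exact mul_le_mul_of_nonneg_left hconv (by positivity)
  have h2 : ∑ b ∈ sb ∪ lb, M₀ * Pt * (2 * (ε₁ * |s⁻¹ - s'⁻¹|) * (Real.sqrt (2 * Real.pi * ‖T (ub b)‖ ^ 2))⁻¹) ≤
      (∑ b ∈ sb ∪ lb, M₀ * Pt * (2 * ε₁ * (Real.sqrt (2 * Real.pi * ‖T (ub b)‖ ^ 2))⁻¹)) * (γ / 2) *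
        |(s ^ 2)⁻¹ - (s' ^ 2)⁻¹| := by
    have hconv := NE9CutoffShell.inv_sub_inv_le hs hsγ hs' hs'γ
    have heq : ∑ b ∈ sb ∪ lb, M₀ * Pt * (2 * (ε₁ * |s⁻¹ - s'⁻¹|) * (Real.sqrt (2 * Real.pi * ‖T (ub b)‖ ^ 2))⁻¹) =
        (∑ b ∈ sb ∪ lb, M₀ * Pt * (2 * ε₁ * (Real.sqrt (2 * Real.pi * ‖T (ub b)‖ ^ 2))⁻¹)) * |s⁻¹ - s'⁻¹| := by
      rw [Finset.sum_mul]
      refine Finset.sum_congr rfl fun b _ => ?_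
      ring
    have hS0 : 0 ≤ ∑ b ∈ sb ∪ lb, M₀ * Pt * (2 * ε₁ * (Real.sqrt (2 * Real.pi * ‖T (ub b)‖ ^ 2))⁻¹) :=
      Finset.sum_nonneg fun b _ => by positivity
    rw [heq, mul_assoc _ (γ / 2)]
    exact mul_le_mul_of_nonneg_left hconv hS0
  calc _ ≤ 4 * |s - s'| / (c * min s s') * (M₁ * Pt) +
        ∑ b ∈ sb ∪ lb, M₀ * Pt * (2 * (ε₁ * |s⁻¹ - s'⁻¹|) * (Real.sqrt (2 * Real.pi * ‖T (ub b)‖ ^ 2))⁻¹) := hg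
    _ ≤ 4 * (M₁ * Pt) / c * (γ ^ 2 / 2) * |(s ^ 2)⁻¹ - (s' ^ 2)⁻¹| +
        (∑ b ∈ sb ∪ lb, M₀ * Pt * (2 * ε₁ * (Real.sqrt (2 * Real.pi * ‖T (ub b)‖ ^ 2))⁻¹)) * (γ / 2) *
          |(s ^ 2)⁻¹ - (s' ^ 2)⁻¹| := add_le_add h1 h2
    _ = _ := by ring

end Summit.QuantumFields.BalabanUV.T4Continuum.NE9FormGaussian

end
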